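import Summits.Ventures.Crystal3D.Bulk.HullRotSysAngles
import HarnessLib

/-!
# Strict Girard for fan triangles: every face of the full hull rotation system has POSITIVE
# excess (companion of seat p3's `excess_univ_nonneg`, `Bulk/HullRotSysAngles.lean`)

HONEST FRAMING. Part of the venture `Summits/Ventures/Crystal3D` (cell `pub-crystal3d`, phase 2;
seat typer-bulk-2); elementary spherical trigonometry, nothing about GAP(1.26).

* `sphExcess_pos_of_orient3_ne_zero` — for unit vectors `a, b, c` with `orient3 a b c ≠ 0`
  the spherical excess `sphExcess a b c` (Literature `SphericalExcessEuler`) is `> 0`: by Euler's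
  formula `1 − cos E = D / ((1+x)(1+y)(1+z))` (`one_sub_cos_sphExcess`) with the Gram
  determinant `D = (orient3 a b c)² > 0` (`orient3_sq_eq_gram`), `cos E < 1`, so `E ≠ 0`; and
  `E ≥ 0` (`sphExcess_nonneg`);
* `HullRotSys.excess_univ_eq_sphExcess` — the excess of the full face of the dart `(y, a)` IS
  the spherical excess of the fan triangle `{a, y, succV X a y}` (the computation inside seat
  p3's `excess_univ_nonneg`, stated as an equality); hence **`HullRotSys.excess_univ_pos`**.
-/

noncomputable section

namespace Summit.Ventures.Crystal3D

open Literature.Geometry.DiscreteGeometry Finset Equiv Real InnerProductGeometry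
open scoped InnerProductSpace

/-! ## Strict positivity of the spherical excess -/

/-- **A non-degenerate spherical triangle has positive excess**: for unit vectors `a, b, c`
with `orient3 a b c ≠ 0`, `0 < sphExcess a b c`. -/
theorem sphExcess_pos_of_orient3_ne_zero {a b c : EuclideanSpace ℝ (Fin 3)} (ha : ‖a‖ = 1)
    (hb : ‖b‖ = 1) (hc : ‖c‖ = 1) (h : orient3 a b c ≠ 0) : 0 < sphExcess a b c := by
  have hli : LinearIndependent ℝ ![a, b, c] := linearIndependent_of_orient3_ne_zero h
  have h0 := sphExcess_nonneg hli
  rcases h0.lt_or_eq with hlt | heq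
  · exact hlt
  exfalso
  have hcos := one_sub_cos_sphExcess ha hb hc hli
  rw [← heq, Real.cos_zero, sub_self] at hcos
  -- the Gram determinant is `(orient3 a b c)² > 0`
  have haa : ⟪a, a⟫_ℝ = 1 := by rw [real_inner_self_eq_norm_sq, ha, one_pow]
  have hbb : ⟪b, b⟫_ℝ = 1 := by rw [real_inner_self_eq_norm_sq, hb, one_pow]
  have hcc : ⟪c, c⟫_ℝ = 1 := by rw [real_inner_self_eq_norm_sq, hc, one_pow]
  have hG : eulerGram ⟪b, c⟫_ℝ ⟪a, c⟫_ℝ ⟪a, b⟫_ℝ = orient3 a b c ^ 2 := by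
    rw [orient3_sq_eq_gram, haa, hbb, hcc, eulerGram_def, real_inner_comm a c]
    ring
  have hGpos : 0 < eulerGram ⟪b, c⟫_ℝ ⟪a, c⟫_ℝ ⟪a, b⟫_ℝ := by rw [hG]; positivity
  -- the side cosines exceed `-1`
  have hx : ⟪b, c⟫_ℝ ^ 2 < 1 :=
    inner_sq_lt_one_of_linearIndependent hb hc (linearIndependent_pair_of_triple₂₃ hli)
  have hy : ⟪a, c⟫_ℝ ^ 2 < 1 :=
    inner_sq_lt_one_of_linearIndependent ha hc (linearIndependent_pair_of_triple₁₃ hli)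
  have hz : ⟪a, b⟫_ℝ ^ 2 < 1 :=
    inner_sq_lt_one_of_linearIndependent ha hb (linearIndependent_pair_of_triple₁₂ hli)
  have hx' : 0 < 1 + ⟪b, c⟫_ℝ := by nlinarith
  have hy' : 0 < 1 + ⟪a, c⟫_ℝ := by nlinarith
  have hz' : 0 < 1 + ⟪a, b⟫_ℝ := by nlinarith
  have hF : 0 < eulerF ⟪b, c⟫_ℝ ⟪a, c⟫_ℝ ⟪a, b⟫_ℝ := by
    rw [eulerF_def]; positivity
  linarith

namespace HullRotSys

variable {X : Finset (EuclideanSpace ℝ (Fin 3))}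
variable {hX1 : ∀ y ∈ X, ‖y‖ = 1}
  {h0 : (0 : EuclideanSpace ℝ (Fin 3)) ∈ interior (convexHull ℝ (X : Set _))}

/-- **The excess of a full face is the spherical excess of its fan triangle**: for the dart
`(y, a)` with `b = succV X a y`, `excess univ (y, a) = sphExcess a y b`. (The computation of
seat p3's `excess_univ_nonneg`, recorded as an equality.) -/
theorem excess_univ_eq_sphExcess {y a : EuclideanSpace ℝ (Fin 3)} (hd : (y, a) ∈ hullDarts X) :
    RotSys.excess (rot hX1 h0) (inv X) (dartWeight X) univ ⟨(y, a), hd⟩ =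
      sphExcess a y (succV X a y) := by
  set φ := RotSys.phi (rot hX1 h0) (inv X) univ with hφ
  set x : ↥(hullDarts X) := ⟨(y, a), hd⟩ with hx
  have hay : (a, y) ∈ hullDarts X := swap_mem_hullDarts hd
  have hP := isPosThird_succV hX1 h0 hay
  set b := succV X a y with hb
  have hba : (b, a) ∈ hullDarts X := mk_mem_hullDarts hP.1 (by simp) (by simp) (Ne.symm hP.ne₁₃)
  have hyb : (y, b) ∈ hullDarts X := mk_mem_hullDarts hP.1 (by simp) (by simp) hP.ne₂₃
  have hsba : succV X b a = y := (succV_eq_iff hX1 h0 hba).2 hP.cyclic.cyclic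
  have hsyb : succV X y b = a := (succV_eq_iff hX1 h0 hyb).2 hP.cyclic
  have h1 : (φ x).1 = (a, b) := by rw [hφ, phi_univ_apply]; rfl
  have h2 : ((φ ^ 2) x).1 = (b, y) := by
    rw [hφ, phi_univ_pow_apply]
    change hullFace X (hullFace X (y, a)) = (b, y)
    rw [hullFace_hullFace hX1 h0 hd]
  have hw0 : dartWeight X (inv X x) = angle (perpTo a y) (perpTo a b) := by
    rw [dartWeight_apply, inv_apply_val]; rfl
  have hw1 : dartWeight X (inv X (φ x)) = angle (perpTo b a) (perpTo b y) := by
    rw [dartWeight_apply, inv_apply_val, h1]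
    change angle (perpTo b a) (perpTo b (succV X b a)) = _
    rw [hsba]
  have hw2 : dartWeight X (inv X ((φ ^ 2) x)) = angle (perpTo y b) (perpTo y a) := by
    rw [dartWeight_apply, inv_apply_val, h2]
    change angle (perpTo y b) (perpTo y (succV X y b)) = _
    rw [hsyb]
  have n01 : x ≠ φ x := fun e => hullFace_ne_self hd (by
    have := congrArg Subtype.val e; rw [h1] at this; exact this.symm)
  have n02 : x ≠ (φ ^ 2) x := fun e => hullFace_hullFace_ne_self hX1 h0 hd (by
    have := congrArg Subtype.val e; rw [hφ, phi_univ_pow_apply] at this; exact this.symm)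
  have n12 : φ x ≠ (φ ^ 2) x := by
    intro e
    apply n01
    have e' : φ (φ x) = φ x := by rw [← Perm.mul_apply, ← pow_two]; exact e.symm
    exact (φ.injective e').symm
  have hface := face_univ_eq (hX1 := hX1) (h0 := h0) x
  unfold RotSys.excess RotSys.faceSum
  rw [hface, sum_insert (by rw [mem_insert, mem_singleton, not_or]; exact ⟨n01, n02⟩),
    sum_insert (by rw [mem_singleton]; exact n12), sum_singleton,
    card_insert_of_notMem (by rw [mem_insert, mem_singleton, not_or]; exact ⟨n01, n02⟩),
    card_insert_of_notMem (by rw [mem_singleton]; exact n12), card_singleton,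
    RotSys.cornerAt_univ, RotSys.cornerAt_univ, RotSys.cornerAt_univ, hw0, hw1, hw2,
    sphExcess_def, angle_comm (perpTo y a) (perpTo y b)]
  push_cast
  ring

/-- **Every face of the full weighted hull rotation system has POSITIVE excess** (strict
Girard: fan triangles are non-degenerate, `orient3 ≠ 0`). -/
theorem excess_univ_pos (d : ↥(hullDarts X)) :
    0 < RotSys.excess (rot hX1 h0) (inv X) (dartWeight X) univ d := by
  obtain ⟨⟨y, a⟩, hd⟩ := d
  rw [excess_univ_eq_sphExcess (hX1 := hX1) (h0 := h0) hd]
  have hay : (a, y) ∈ hullDarts X := swap_mem_hullDarts hd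
  have hP := isPosThird_succV hX1 h0 hay
  have hyX : y ∈ X := fst_mem_of_mem_hullDarts hX1 hd
  have haX : a ∈ X := snd_mem_of_mem_hullDarts hX1 hd
  have hbX : succV X a y ∈ X := subset_of_mem_fanTriSets hX1 hP.1 (by simp)
  exact sphExcess_pos_of_orient3_ne_zero (hX1 a haX) (hX1 y hyX) (hX1 _ hbX) hP.2.ne'

end HullRotSys

end Summit.Ventures.Crystal3D

end
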